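import Literature.NumberTheory.Automorphic.TorusOrbitalDescentTwist
import Literature.NumberTheory.Automorphic.ConstantTermUnitElement
import Literature.MeasureTheory.Group.InvariantQuotientCompactOpenMass
import Literature.MeasureTheory.Group.InvariantQuotientTransport
import Literature.NumberTheory.Automorphic.LocalOrbitalMeasure
import HarnessLib

/-!
# Torus descent of the UNIT orbital integral against the canonical quotient measure `ν∕t_T`: the Iwasawa constant CANCELS
(Rogawski (1990), §4.9 (4.9.2) p. 55 «`Φ(γ, 1_K) = |D(γ)|^{-1∕2}·(1_K)^{(B)}(γ)`» in the Levi case of Prop. 4.9.1 (b); §4.13 Lemma 4.13.1 (a)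
p. 64 and its proof p. 70 «`G = KP`, `P = MU`, `dg = dk dm du`»; §4.3 (4.3.1) p. 43 compatible measures; §4.4 p. 44 `vol K = 1`; Deitmar–Echterhoff
(2014) Thm. 1.5.3; Gelbart (1975) Thm. 9.22 (iii))

Topic `NumberTheory/Automorphic`; namespace `Literature.NumberTheory.Automorphic`.  KERNEL mathematics only: theorems, no definition, no named
fact, no instance, no `sorry`.  Cell `pub/hodgecm-mathlib`, programme P3a, road «D-N7-inert» (map v2 f057cb56 §1 row L8), brick «JUNCTION-Levi» FILE B
(LEAD F0P3a-plan (g9) T8-20 (D)(1); cut-holder F0P3b-p01 (g6)).  GENERIC layer over ★ B-p12 `TorusOrbitalDescentTwist` (the descent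
`∫_{G⧸T} F(y t y⁻¹) dμ = C·J·∫_{K×N} F(k (t n) k⁻¹)` from the measure identity `μ = C • ((k,n) ↦ k n T)_*(κ ⊗ μ_N)` and the twist binder `hJac`)
and ★ A-p06 `ConstantTermUnitElement` (the `K`-averaged constant term of `1_K` is `κ(K)·μ_N(N ∩ K)·1_K(t)` in good position).  HONEST LABEL: HC_CM is
proved only modulo the 2 remaining named inputs (hLiu418, h413) until rung 0 closes; this file discharges no named fact.

THE POINT.  The Iwasawa constant `C` of ★ `KNAQuotientIntegration.exists_measure_quotient_eq_smul_map` is UNSPECIFIED (`∃ C ≠ 0`); for the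
CANONICAL quotient measure `μ = ν∕t_T` (★ `quotientMeasure`) it is pinned by ONE evaluation on the open set `π(K)`: `(ν∕t_T)(π(K))·t_T(T ∩ K) = ν(K)`
(★ `quotientMeasure_image_mk_eq_one`) while the Iwasawa preimage of `π(K)` is `K × (N ∩ K)` (good position `m u ∈ K ⇒ m ∈ K` for `m ∈ T`, `u ∈ N`,
`T` normalising `N`), so **`C·κ(K)·μ_N(N ∩ K) = 1` whenever `ν(K) = t_T(T ∩ K) = 1`** — and this is EXACTLY the factor the unit constant term
produces.  Hence, with NO normalisation of `κ` or `μ_N`: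
* §1 `mk_mul_mem_image_iff_of_good_position`, `preimage_mk_mul_image_eq_univ_prod` (the preimage), **`coe_mul_measure_mul_measure_eq_one_of_quotientMeasure_eq_smul_map`**
  (`C·κ(K)·μ_N(N∩K) = 1`), **`lintegral_descConj_indicator_quotientMeasure_eq_of_eq_smul_map`**: `∫⁻_{G⧸T} 1_K(y t y⁻¹) d(ν∕t_T) = J·1_K(t)` for
  `t ∈ T` with twist module `J`.
* §2 **`lintegral_descConj_centralizer_indicator_eq_of_mulEquiv`** — the same read on an isomorphic group `G′` (bicontinuous `Ψ : G′ ≃* G` with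
  `Ψ(Z(γ₀)) = T`, `Ψ(K′) = K`, `ν = Ψ_*ν′`, `t_T = Ψ_*t_Z`): `∫⁻_{G′⧸Z(γ₀)} 1_{K′}(x γ₀ x⁻¹) d(ν′∕t_Z) = J·1_K(Ψγ₀)` (★
  `InvariantQuotientTransport.lintegral_descConj_quotientMeasure_eq_of_mulEquiv`) — the shape in which the inner form `U(H′)(L⁺_v) ≃ U(Φ₃)(L⁺_v)` at a
  good non-split place (★ `LocalUnitaryIntegralLevel`) and the centraliser `Z(t) = T` of a regular torus element are consumed (FILE C).
NOT here: the value of `J` (★ A-p12 `UnitaryGroupHeisenbergRingRegularTwist` at `N = 3`), `compactCore T = T ∩ K` (FILE C), the `H`-side.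

## References
* [Rogawski1990] J. D. Rogawski, *Automorphic Representations of Unitary Groups in Three Variables*, Ann. of Math. Stud. 123 (1990), §4.9
  (4.9.2) p. 55; §4.13 Lemma 4.13.1 (a) p. 64, proof p. 70; §4.3 (4.3.1) p. 43; §4.4 p. 44; §14.2 p. 232.
* [DeitmarEchterhoff2014] A. Deitmar, S. Echterhoff, *Principles of Harmonic Analysis*, 2nd ed. (2014), Thm. 1.5.3.
* [Gelbart1975] S. Gelbart, *Automorphic Forms on Adele Groups*, Ann. of Math. Stud. 83 (1975), Thm. 9.22 (iii), Remark 9.23.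
* [CartierCorvallis1979] P. Cartier, *Representations of 𝔭-adic groups: a survey*, PSPM 33.1 (1979), §IV (4.2).
-/

set_option autoImplicit false

noncomputable section

open MeasureTheory Measure Set Filter Topology
open scoped ENNReal NNReal

namespace Literature.NumberTheory.Automorphic

open Literature.MeasureTheory.Group

universe u

/-! ## §1 The Iwasawa constant of `ν∕t_T` cancels against the unit constant term -/

section Generic

variable {G : Type u} [Group G] [TopologicalSpace G] [IsTopologicalGroup G] [LocallyCompactSpace G]
  [T2Space G] [SecondCountableTopology G] [MeasurableSpace G] [BorelSpace G]
  {K T N : Subgroup G} (hKo : IsOpen (K : Set G)) (hT : IsClosed (T : Set G))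
  (hTN : ∀ a ∈ T, ∀ n ∈ N, a * n * a⁻¹ ∈ N)
  (hKP : ∀ ⦃m u : G⦄, m ∈ T → u ∈ N → m * u ∈ K → m ∈ K)
  (ν : Measure G) [IsHaarMeasure ν] [ν.IsMulRightInvariant]
  (tT : Measure ↥T) [tT.IsHaarMeasure] [tT.IsInvInvariant]
  (κ : Measure ↥K) (μN : Measure ↥N) [SFinite μN]
  [MeasurableSpace (G ⧸ T)] [BorelSpace (G ⧸ T)]

omit [TopologicalSpace G] [IsTopologicalGroup G] [LocallyCompactSpace G] [T2Space G] [SecondCountableTopology G] [MeasurableSpace G]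
  [BorelSpace G] [MeasurableSpace (G ⧸ T)] [BorelSpace (G ⧸ T)] in
include hTN hKP in
/-- **The Iwasawa preimage of `π(K) ⊂ G ⧸ T` is `K × (N ∩ K)`** (good position of `K` with respect to `T·N`, `T` normalising `N`): for `k ∈ K`, `n ∈ N`,
`(k n) T ∈ π(K) ↔ n ∈ K`. [cite: Rogawski1990, §4.13 p. 70] [cite: CartierCorvallis1979, §IV (4.2)] -/
theorem mk_mul_mem_image_iff_of_good_position (k : ↥K) (n : ↥N) :
    (QuotientGroup.mk ((k : G) * (n : G)) : G ⧸ T) ∈ (QuotientGroup.mk : G → G ⧸ T) '' (K : Set G) ↔ (n : G) ∈ K := by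
  constructor
  · rintro ⟨k', hk', hk'eq⟩
    rw [QuotientGroup.eq] at hk'eq
    -- `k'⁻¹ (k n) ∈ T`; put `s := k'⁻¹ k n`, then `n = (k⁻¹ k') s`… work with `s⁻¹ = (k n)⁻¹ k'`
    set s : G := (k' : G)⁻¹ * ((k : G) * (n : G)) with hs
    have hsT : s ∈ T := hk'eq
    -- `n s⁻¹ = k⁻¹ k' ∈ K`, and `n s⁻¹ = s⁻¹ (s n s⁻¹)` with `s⁻¹ ∈ T`, `s n s⁻¹ ∈ N`
    have hns : (n : G) * s⁻¹ ∈ K := by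
      have h1 : (n : G) * s⁻¹ = (k : G)⁻¹ * k' := by rw [hs]; group
      rw [h1]
      exact K.mul_mem (K.inv_mem k.2) hk'
    have hconj : s * (n : G) * s⁻¹ ∈ N := hTN s hsT n n.2
    have h2 : (n : G) * s⁻¹ = s⁻¹ * (s * (n : G) * s⁻¹) := by group
    rw [h2] at hns
    have h3 := mem_and_mem_of_levi_mul_unipotent_mem hKP (T.inv_mem hsT) hconj hns
    have h4 : (n : G) = s⁻¹ * (s * (n : G) * s⁻¹) * s := by group
    rw [h4]
    exact K.mul_mem (K.mul_mem h3.1 h3.2) ((Subgroup.inv_mem_iff K).1 h3.1)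
  · intro hn
    exact ⟨(k : G) * (n : G), K.mul_mem k.2 hn, rfl⟩

omit [TopologicalSpace G] [IsTopologicalGroup G] [LocallyCompactSpace G] [T2Space G] [SecondCountableTopology G] [MeasurableSpace G]
  [BorelSpace G] [MeasurableSpace (G ⧸ T)] [BorelSpace (G ⧸ T)] in
include hTN hKP in
/-- The preimage of `π(K)` under the Iwasawa chart `(k, n) ↦ (k n) T` is `univ ×ˢ {n | n ∈ K}`. [cite: Rogawski1990, §4.13 p. 70] -/
theorem preimage_mk_mul_image_eq_univ_prod :
    (fun p : ↥K × ↥N => (QuotientGroup.mk ((p.1 : G) * (p.2 : G)) : G ⧸ T)) ⁻¹' ((QuotientGroup.mk : G → G ⧸ T) '' (K : Set G)) =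
      (univ : Set ↥K) ×ˢ {n : ↥N | (n : G) ∈ K} := by
  ext p
  rw [mem_preimage, mk_mul_mem_image_iff_of_good_position hTN hKP p.1 p.2, mem_prod]
  simp only [mem_univ, true_and, mem_setOf_eq]

include hKo hTN hKP in
/-- **THE IWASAWA CONSTANT OF THE CANONICAL QUOTIENT MEASURE IS PINNED BY THE `K`-MASSES**: if `ν∕t_T = C • ((k, n) ↦ k n T)_* (κ ⊗ μ_N)` on `G ⧸ T`
with `ν(K) = 1` and `t_T(T ∩ K) = 1`, then `C · κ(K) · μ_N(N ∩ K) = 1` (both sides are the mass of the open set `π(K)`: ★ `quotientMeasure_image_mk_eq_one`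
and the preimage computation above). [cite: Rogawski1990, §4.13, proof of Lemma 4.13.1, p. 70; §4.4 p. 44] [cite: DeitmarEchterhoff2014, Thm. 1.5.3] -/
theorem coe_mul_measure_mul_measure_eq_one_of_quotientMeasure_eq_smul_map {C : ℝ≥0}
    (hμC : quotientMeasure T tT hT ν = C • Measure.map (fun p : ↥K × ↥N => (QuotientGroup.mk ((p.1 : G) * (p.2 : G)) : G ⧸ T)) (κ.prod μN))
    (hν : ν K = 1) (htK : tT (Subtype.val ⁻¹' (K : Set G)) = 1) :
    (C : ℝ≥0∞) * (κ univ * μN {n : ↥N | (n : G) ∈ K}) = 1 := by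
  haveI : SecondCountableTopology ↥K := TopologicalSpace.Subtype.secondCountableTopology _
  haveI : SecondCountableTopology ↥N := TopologicalSpace.Subtype.secondCountableTopology _
  haveI : BorelSpace (↥K × ↥N) := Prod.borelSpace
  have h1 := quotientMeasure_image_mk_eq_one T tT ν K hKo hν htK
  have hmk : Measurable fun p : ↥K × ↥N => (QuotientGroup.mk ((p.1 : G) * (p.2 : G)) : G ⧸ T) :=
    (continuous_quotient_mk'.comp ((continuous_subtype_val.comp continuous_fst).mul
      (continuous_subtype_val.comp continuous_snd))).measurable
  have hopen : MeasurableSet ((QuotientGroup.mk : G → G ⧸ T) '' (K : Set G)) :=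
    (QuotientGroup.isOpenMap_coe (K : Set G) hKo).measurableSet
  rw [hμC, Measure.smul_apply, Measure.map_apply hmk hopen, preimage_mk_mul_image_eq_univ_prod hTN hKP,
    Measure.prod_prod, ENNReal.smul_def, smul_eq_mul] at h1
  exact h1

include hKo hTN hKP in
/-- **TORUS DESCENT OF THE UNIT ORBITAL INTEGRAL WITH THE CANONICAL QUOTIENT MEASURE — the Iwasawa constant cancels**: under
`ν∕t_T = C • ((k, n) ↦ k n T)_* (κ ⊗ μ_N)`, `ν(K) = 1`, `t_T(T ∩ K) = 1`, for `t` centralised by `T` and lying in `T` (good position), with twist module `J` on `N`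
(the property binder `hJac` of ★ `TorusOrbitalDescentTwist`):
**`∫⁻_{G ⧸ T} 1_K(y t y⁻¹) d(ν∕t_T) = J · 1_K(t)`** — ★ `lintegral_descConj_eq_mul_lintegral_prod_torus_mul_unipotent_of_eq_smul_map` (`= C·J·∫_{K×N} 1_K(k (t n) k⁻¹)`),
★ `lintegral_prod_indicator_conj_levi_mul_unipotent_of_mem` (`= C·J·κ(K)·μ_N(N ∩ K)·1_K(t)`) and the pinning `C·κ(K)·μ_N(N ∩ K) = 1`: NO normalisation of
`κ`, `μ_N` is needed.  This is `Φ(t, 1_K) = |D(t)|⁻¹·(1_K)^{(B)}(t)` [Rogawski1990 (4.9.2)] with the compatible measures of §4.3.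
[cite: Rogawski1990, §4.9 (4.9.2) p. 55; §4.13 Lemma 4.13.1 (a) p. 64, p. 70] [cite: DeitmarEchterhoff2014, Thm. 1.5.3] -/
theorem lintegral_descConj_indicator_quotientMeasure_eq_of_eq_smul_map {C : ℝ≥0}
    (hμC : quotientMeasure T tT hT ν = C • Measure.map (fun p : ↥K × ↥N => (QuotientGroup.mk ((p.1 : G) * (p.2 : G)) : G ⧸ T)) (κ.prod μN))
    (hν : ν K = 1) (htK : tT (Subtype.val ⁻¹' (K : Set G)) = 1)
    {t : G} (htT : t ∈ T) (ht : ∀ a ∈ T, a * t = t * a) {J : ℝ≥0∞}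
    (hJac : ∀ Φ : G → ℝ≥0∞, Measurable Φ → ∫⁻ n, Φ ((n : G) * t * (n : G)⁻¹) ∂μN = J * ∫⁻ n, Φ (t * (n : G)) ∂μN) :
    ∫⁻ y, descConj t T ht ((K : Set G).indicator 1) y ∂(quotientMeasure T tT hT ν) = J * (K : Set G).indicator 1 t := by
  have hF : Measurable ((K : Set G).indicator (1 : G → ℝ≥0∞)) := measurable_one.indicator hKo.measurableSet
  rw [lintegral_descConj_eq_mul_lintegral_prod_torus_mul_unipotent_of_eq_smul_map hT κ μN _ hμC t ht hJac hF,
    lintegral_prod_indicator_conj_levi_mul_unipotent_of_mem κ (k := fun x : ↥K => (x : G)) (fun x => x.2) μN hKP htT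
      (measurableSet_setOf_coe_mem_of_isOpen hKo)]
  have h1 := coe_mul_measure_mul_measure_eq_one_of_quotientMeasure_eq_smul_map hKo hT hTN hKP ν tT κ μN hμC hν htK
  calc (C : ℝ≥0∞) * J * (κ univ * μN {n : ↥N | (n : G) ∈ K} * (K : Set G).indicator 1 t)
      = J * (K : Set G).indicator 1 t * ((C : ℝ≥0∞) * (κ univ * μN {n : ↥N | (n : G) ∈ K})) := by ring
    _ = J * (K : Set G).indicator 1 t := by rw [h1, mul_one]

end Generic

/-! ## §2 Transported form: the unit orbital integral on an isomorphic group `G′` read on `G ⧸ T` -/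

section Transport

variable {G : Type u} [Group G] [TopologicalSpace G] [IsTopologicalGroup G] [LocallyCompactSpace G]
  [T2Space G] [SecondCountableTopology G] [MeasurableSpace G] [BorelSpace G]
  {G' : Type u} [Group G'] [TopologicalSpace G'] [IsTopologicalGroup G'] [LocallyCompactSpace G']
  [T2Space G'] [SecondCountableTopology G'] [MeasurableSpace G'] [BorelSpace G']
  {K T N : Subgroup G} (hKo : IsOpen (K : Set G)) (hT : IsClosed (T : Set G))
  (hTN : ∀ a ∈ T, ∀ n ∈ N, a * n * a⁻¹ ∈ N)
  (hKP : ∀ ⦃m u : G⦄, m ∈ T → u ∈ N → m * u ∈ K → m ∈ K)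
  (ν : Measure G) [IsHaarMeasure ν] [ν.IsMulRightInvariant]
  (tT : Measure ↥T) [tT.IsHaarMeasure] [tT.IsInvInvariant]
  (κ : Measure ↥K) (μN : Measure ↥N) [SFinite μN]
  [MeasurableSpace (G ⧸ T)] [BorelSpace (G ⧸ T)]

include hKo hTN hKP in
/-- **The unit orbital integral at `γ₀ ∈ G′` TRANSPORTED to `G ⧸ T`**: for a bicontinuous isomorphism `Ψ : G′ ≃* G` carrying the centraliser
`Z(γ₀)` onto `T` and `K′` onto `K`, with `ν = Ψ_* ν′` and `t_T = (Ψ|_{Z(γ₀)})_* t_Z`, and the hypotheses of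
`lintegral_descConj_indicator_quotientMeasure_eq_of_eq_smul_map` at `t = Ψ γ₀`:
**`∫⁻_{G′ ⧸ Z(γ₀)} 1_{K′}(x γ₀ x⁻¹) d(ν′∕t_Z) = J · 1_K(Ψ γ₀)`** (★ `lintegral_descConj_quotientMeasure_eq_of_mulEquiv`).  The shape the inner form
`U(H′)(L⁺_v) ≃ U(Φ₃)(L⁺_v)` at a good non-split place is consumed in. [cite: Rogawski1990, §4.9 (4.9.2) p. 55; §14.2 p. 232] [cite: DeitmarEchterhoff2014, Thm. 1.5.3] -/
theorem lintegral_descConj_centralizer_indicator_eq_of_mulEquiv (Ψ : G' ≃* G) (hΨ : Continuous Ψ) (hΨs : Continuous Ψ.symm)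
    (γ₀ : G') (hZT : ∀ g, Ψ g ∈ T ↔ g ∈ Subgroup.centralizer ({γ₀} : Set G'))
    [MeasurableSpace (G' ⧸ Subgroup.centralizer ({γ₀} : Set G'))] [BorelSpace (G' ⧸ Subgroup.centralizer ({γ₀} : Set G'))]
    (ν' : Measure G') [IsHaarMeasure ν'] [ν'.IsMulRightInvariant] (hν' : ν = Measure.map Ψ ν')
    (tZ : Measure ↥(Subgroup.centralizer ({γ₀} : Set G'))) [tZ.IsHaarMeasure] [tZ.IsInvInvariant]
    (htZ : tT = Measure.map (subgroupCongrHomeomorph Ψ (Subgroup.centralizer ({γ₀} : Set G')) T hZT hΨ hΨs) tZ)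
    (K' : Subgroup G') (hK' : ∀ g, g ∈ K' ↔ Ψ g ∈ K) {C : ℝ≥0}
    (hμC : quotientMeasure T tT hT ν = C • Measure.map (fun p : ↥K × ↥N => (QuotientGroup.mk ((p.1 : G) * (p.2 : G)) : G ⧸ T)) (κ.prod μN))
    (hν : ν K = 1) (htK : tT (Subtype.val ⁻¹' (K : Set G)) = 1)
    (htT : Ψ γ₀ ∈ T) (ht : ∀ a ∈ T, a * Ψ γ₀ = Ψ γ₀ * a) {J : ℝ≥0∞}
    (hJac : ∀ Φ : G → ℝ≥0∞, Measurable Φ → ∫⁻ n, Φ ((n : G) * Ψ γ₀ * (n : G)⁻¹) ∂μN = J * ∫⁻ n, Φ (Ψ γ₀ * (n : G)) ∂μN) :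
    ∫⁻ y, descConj γ₀ (Subgroup.centralizer ({γ₀} : Set G')) (fun _ hg => Subgroup.mem_centralizer_singleton_iff.1 hg) ((K' : Set G').indicator 1) y
        ∂(quotientMeasure (Subgroup.centralizer ({γ₀} : Set G')) tZ (isClosed_coe_centralizer_singleton γ₀) ν') =
      J * (K : Set G).indicator 1 (Ψ γ₀) := by
  haveI : IsClosed ((Subgroup.centralizer ({γ₀} : Set G') : Subgroup G') : Set G') := isClosed_coe_centralizer_singleton γ₀
  haveI : IsClosed ((T : Subgroup G) : Set G) := hT
  have hF : ((K' : Set G').indicator (1 : G' → ℝ≥0∞)) = ((K : Set G).indicator (1 : G → ℝ≥0∞)) ∘ Ψ := by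
    funext g
    by_cases hg : g ∈ K'
    · rw [Set.indicator_of_mem (show g ∈ (K' : Set G') from hg), Function.comp_apply,
        Set.indicator_of_mem (show Ψ g ∈ (K : Set G) from (hK' g).1 hg)]
      rfl
    · rw [Set.indicator_of_notMem (show g ∉ (K' : Set G') from hg), Function.comp_apply,
        Set.indicator_of_notMem (show Ψ g ∉ (K : Set G) from fun h => hg ((hK' g).2 h))]
  rw [hF, ← lintegral_descConj_quotientMeasure_eq_of_mulEquiv Ψ hΨ hΨs (Subgroup.centralizer ({γ₀} : Set G')) T hZT tZ tT ν' ν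
    htZ hν' (fun _ hg => Subgroup.mem_centralizer_singleton_iff.1 hg) ht]
  exact lintegral_descConj_indicator_quotientMeasure_eq_of_eq_smul_map hKo hT hTN hKP ν tT κ μN hμC hν htK htT ht hJac

end Transport

end Literature.NumberTheory.Automorphic

end
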